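import Summits.Ventures.PercRepro.S1CoreCapSpecFourSimple

/-!
# PercRepro — THE INSTANCE `ν = 4` OF THE 4-CIRCUIT-CAP SPEC, PROVED (p1, gen 23)

`fourCapSpec_four : FourCapSpec capPaper 4 8` — the searches' value `Q*(4) = 8` is a theorem of the kernel. At
nullity `4` a configuration is (i) one line (cap `≤ 5`), (ii) two lines (`cap_add_cap_le_eight`: the cell
`(4,0) + (4,0)`), or (iii) `≥ 3` lines, all of weight `≤ 4` (`wsum_le_four_of_two_lt_card`): if one of them has
weight `4` there are at most `4` lines (`card_le_four_of_weight_four`) — a simple 4-point line makes every other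
line a simple 3-point line (cap `4 + 3`), a one-fat 3-point line makes every line a 3-point line of cap `≤ 2`
(cap `≤ 2 · 4`); if all have weight `3` they are at most `8` simple 3-point lines (`card_le_eight_of_three_points`,
cap `≤ 8`). With `fourCapSpec_three` this leaves `Q*(5) = 11` as the only computed instance behind the bounds of
`S1CoreCapSum` / `S1CoreCapAvg`. Axioms: standard.
-/

namespace PercRepro

namespace S1

namespace FourCap

variable {β : Type} [DecidableEq β]

/-- A third line, different from two given ones, in a configuration with `≥ 3` lines. -/
theorem exists_third {ls : Finset (Finset β)} (hbig : 2 < ls.card) {L L' : Finset β} (hL : L ∈ ls)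
    (hL' : L' ∈ ls) (hne : L ≠ L') : ∃ L₃ ∈ ls, L₃ ≠ L ∧ L₃ ≠ L' := by
  have hL'' : L' ∈ ls.erase L := Finset.mem_erase.2 ⟨hne.symm, hL'⟩
  have hpos : 0 < ((ls.erase L).erase L').card := by
    rw [Finset.card_erase_of_mem hL'', Finset.card_erase_of_mem hL]
    omega
  obtain ⟨L₃, hL₃⟩ := Finset.card_pos.1 hpos
  simp only [Finset.mem_erase] at hL₃
  exact ⟨L₃, hL₃.2.2, hL₃.2.1, hL₃.1⟩

/-- The cap of a 3-point line with at most one fat point is `≤ 2`. -/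
theorem capPaper_three_le_two {f : ℕ} (hf : f ≤ 1) : capPaper 3 f ≤ 2 := by
  rcases (by omega : f = 0 ∨ f = 1) with rfl | rfl <;> decide

/-- **THE INSTANCE `ν = 4`, PROVED**: `FourCapSpec capPaper 4 8` — the searches' `Q*(4) = 8` is a theorem. -/
theorem fourCapSpec_four : FourCapSpec capPaper 4 8 := by
  intro β _ w ls h1 h2 h3 h4 _ _
  by_cases hbig : 2 < ls.card
  · have hw4 : ∀ L ∈ ls, wsum w L ≤ 4 := wsum_le_four_of_two_lt_card h1 h2 h3 h4 hbig
    by_cases hex : ∃ L ∈ ls, wsum w L = 4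
    · -- a line of weight `4`: at most four lines
      obtain ⟨L₁, hL₁, hwL₁⟩ := hex
      have hm := card_le_four_of_weight_four h1 h2 h3 h4 hL₁ hwL₁
      have hshape : ∀ L ∈ ls, L ≠ L₁ → L.card = 3 ∧ fat w (L \ L₁) = 0 := by
        intro L hL hne
        obtain ⟨L₃, hL₃, h3L, h31⟩ := exists_third hbig hL hL₁ hne
        exact shape_of_weight_four h1 h2 h3 h4 hL₁ hL hL₃ hne h31 h3L hwL₁
      have hcf₁ := wsum_eq_card_add_fat w L₁ (h1 L₁ hL₁)
      have hk₁ := (h2 L₁ hL₁).1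
      rcases (by omega : L₁.card = 4 ∨ L₁.card = 3) with hc4 | hc3
      · -- a simple 4-point line: every other line is a simple 3-point line
        have hf₁ : fat w L₁ = 0 := by omega
        have hothers : ∀ L ∈ ls.erase L₁, capPaper L.card (fat w L) = 1 := by
          intro L hL
          rw [Finset.mem_erase] at hL
          obtain ⟨hc, hf⟩ := hshape L hL.2 hL.1
          have hsplit := fat_sdiff_add_fat_inter w L L₁
          have hmono := fat_mono w (Finset.inter_subset_right : L ∩ L₁ ⊆ L₁)
          have hf0 : fat w L = 0 := by omega
          rw [hc, hf0]
          decide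
        rw [← Finset.add_sum_erase ls _ hL₁, Finset.sum_congr rfl hothers, Finset.sum_const_nat (fun _ _ => rfl),
          Finset.card_erase_of_mem hL₁, hc4, hf₁]
        have : capPaper 4 0 = 4 := by decide
        omega
      · -- a one-fat 3-point line: every line is a 3-point line of cap `≤ 2`
        have hcap : ∀ L ∈ ls, capPaper L.card (fat w L) ≤ 2 := by
          intro L hL
          have hcf := wsum_eq_card_add_fat w L (h1 L hL)
          have hk := (h2 L hL).1
          have hw := hw4 L hL
          have hc : L.card = 3 := by
            by_cases hne : L = L₁
            · rw [hne]; exact hc3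
            · exact (hshape L hL hne).1
          rw [hc]
          exact capPaper_three_le_two (by omega)
        calc ∑ L ∈ ls, capPaper L.card (fat w L) ≤ ∑ L ∈ ls, 2 := Finset.sum_le_sum hcap
          _ = ls.card * 2 := Finset.sum_const_nat (fun _ _ => rfl)
          _ ≤ 8 := by omega
    · -- every line has weight `3`: at most eight simple 3-point lines
      push Not at hex
      have hcard : ∀ L ∈ ls, L.card = 3 := by
        intro L hL
        have := hw4 L hL
        have := hex L hL
        have := card_le_wsum w L (h1 L hL)
        have := (h2 L hL).1
        omega
      have hcap : ∀ L ∈ ls, capPaper L.card (fat w L) = 1 := by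
        intro L hL
        have hcf := wsum_eq_card_add_fat w L (h1 L hL)
        have hc := hcard L hL
        have hf : fat w L = 0 := by
          have := hw4 L hL
          have := hex L hL
          omega
        rw [hc, hf]
        decide
      have hm := card_le_eight_of_three_points h1 hcard h3 h4
      calc ∑ L ∈ ls, capPaper L.card (fat w L) = ∑ L ∈ ls, 1 := Finset.sum_congr rfl hcap
        _ = ls.card := by simp
        _ ≤ 8 := hm
  · push Not at hbig
    rcases (by omega : ls.card = 0 ∨ ls.card = 1 ∨ ls.card = 2) with h0 | hone | htwo
    · rw [Finset.card_eq_zero.1 h0]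
      simp
    · obtain ⟨L, rfl⟩ := Finset.card_eq_one.1 hone
      rw [Finset.sum_singleton]
      have hk := h2 L (Finset.mem_singleton_self L)
      have hcf := wsum_eq_card_add_fat w L (h1 L (Finset.mem_singleton_self L))
      exact (capPaper_le_five hk.1 (by omega)).trans (by omega)
    · obtain ⟨L, L', hne, rfl⟩ := Finset.card_eq_two.1 htwo
      rw [Finset.sum_pair hne]
      exact cap_add_cap_le_eight h1 h2 h3 h4 (by simp) (by simp) hne.symm

end FourCap

end S1

end PercRepro
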